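import Literature.MathematicalPhysics.QuantumFieldTheory.Balaban1983to89.NodeOLettersSqrtAlmostLocal

/-!
# `Balaban1983to89.NodeOLettersSqrtExpDecay` — T. Bałaban, *Renormalization group approach to lattice gauge field
theories. II. Cluster expansions*, Commun. Math. Phys. **116** (1988) 1–22 [Balaban1988RG2Cluster], (2.7) p. 13 ∕
(2.16) p. 16 with [13] = *Propagators for lattice gauge theories in a background field*, Commun. Math. Phys. **99** (1985) 389–434 [Balaban1985BackgroundPropagators], Thm 3.10 pp. 415–416, (3.107)–(3.108) p. 416 ([II] p. 22 cites through [I] CMP **109** p. 299): NODE O's letters (L1)–(L3)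
for the square-root family `(C^{(k)})^{1/2}` from EXPONENTIAL-DECAY precision letters — the k-UNIFORM RATE RECIPE that
turns «`‖P_{il}‖ ≤ a·e^{−κ₀ d(i,l)}`, `m`-accretive, volume sums `≤ c_V`» into the `(e^{κd} − 1)`-WEIGHTED Combes–Thomas
hypothesis of `B13Sqrt27AccretiveAlmostLocal` (p427529) ∕ `NodeOLettersSqrtAlmostLocal` (p427959), by name

statement-level skeleton of published theorems with citation tags; proofs where landed; nothing here is a claim about
the Yang–Mills mass gap

WHY THIS FILE.  The tree's almost-local square-root chain — `B13Sqrt27AccretiveAlmostLocal.almostLocal_inverse_decay` ∕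
`almostLocal_resolvent_decay` ∕ `norm_invSqrt_apply_le_almostLocal` ∕ `norm_invSqrt_sub_apply_le_almostLocal` and the
junction `NodeOLettersSqrtAlmostLocal.kernelLetters_invSqrt_almostLocal` — asks the precision `P σ u` to have
`(e^{κ·d₁} − 1)`-weighted absolute off-diagonal row AND column sums `≤ ϱ ≤ m/2` at SOME rate `κ ≥ 0`.  What print supplies
for Bałaban's `C*Δ_k(σ,𝐔,𝐉)C` of (1.21) is not that hypothesis but EXPONENTIAL LOCALISATION: *"Expanding the operator Δ_k
into the generalized random walks, we obtain an expansion of the series above"* (p. 13), i.e. kernel bounds `|P(x, x′)| ≤ O(1)·e^{−δ d(x,x′)}` with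
`O(1), δ` uniform in `k` ([13] Thm 3.10 ∕ (2.16) p. 16: `|R₁(b,b′)| ≦ (O(1)e^{−⅓δ₀M} + O(α₀ + α₁))exp(−½δ₀|b₋ − b′₋|)`).
This file is the one-line-per-letter bridge between the two: under `‖P_{il}‖ ≤ a·e^{−κ₀ d(i,l)}` (`a ≥ 0`, `κ₀ > 0`) with
HALF-RATE volume sums `Σ_l e^{−(κ₀/2)d(i,l)} ≤ c_V`, every rate `κ` with `0 ≤ κ ≤ κ₀/4` and `8aκ·c_V ≤ mκ₀` gives weighted
row and column sums `≤ m/2` (§1) — `κ` is a function of the k-uniform letters `(m; a, κ₀, c_V)` ONLY, and such a `κ > 0`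
always exists (`exists_uniform_rate`) — whence NODE O's `KernelLetters` for `σ u ↦ (P σ u)^{−1/2}` with no weighted-sum
hypothesis left (§2, `kernelLetters_invSqrt_of_expDecay`, = `kernelLetters_invSqrt_almostLocal` with `hrow`∕`hcol`
DISCHARGED).  §1 also records that the RANGE-ONE hypothesis of `B13Sqrt27Accretive` ∕ `NodeOLettersSqrt` (p422202 ∕
p424729: off-diagonal sums `≤ h`, `dist ≤ 1` on the support) is the special case `ϱ = h(e^κ − 1)` of the weighted one
(`weightedRowSum_le_of_rangeOne` ∕ `weightedColSum_le_of_rangeOne`).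

CITATION HEADER (verbatim, p. 13 [PDF 13]; render-checked): *"This construction was discussed in [13] for all operators
determining Δ_k, and for C^{(k)}(Z₀), but not for (C^{(k)})^{1/2}."*; *"Expanding the operator Δ_k into the generalized random
walks, we obtain an expansion of the series above, if γ₁ is sufficiently large."*; *"This term determines a nonnegative, bounded
and almost local operator. … The operator G̃₃(x) has the same properties as G̃₂, especially it can be expanded into a generalized random walk expansion."*

WHAT IS REPRODUCED (cell `ym-nodeO-ideate`, seat P2 «around Bałaban»; the non-overlapping remainder of that cell's
companion `NodeOLettersSqrtLocalised` after p427529 ∕ p427959 landed the weighted chain — first-landed rule; notation of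
`B13Sqrt27AccretiveAlmostLocal`):
* §1 `weightedRowSum_le_of_expDecay_linear` ∕ `weightedColSum_le_of_expDecay_linear` — `‖A_{il}‖ ≤ a·e^{−κ₀ d(i,l)}`,
  `Σ_l e^{−(κ₀/2)d(i,l)} ≤ c_V`, `0 ≤ κ ≤ κ₀/4` ⟹ `Σ_l ‖A_{il}‖(e^{κ d(i,l)} − 1) ≤ (4aκ/κ₀)·c_V` (`e^{y} − 1 ≤ y e^{y}`,
  `t·e^{−κ₀t/4} ≤ 4/κ₀`); **`weightedSums_le_half_of_expDecay`** — plus `8aκ·c_V ≤ mκ₀` ⟹ both weighted sums `≤ m/2`;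
  `exists_uniform_rate` — a `κ > 0` with these two properties exists for every `m > 0`, `κ₀ > 0`, `a, c_V ≥ 0`;
  `weightedRowSum_le_of_rangeOne` ∕ `weightedColSum_le_of_rangeOne` — range one with sums `≤ h` ⟹ weighted sums
  `≤ h(e^κ − 1)`.
* §2 **`kernelLetters_invSqrt_of_expDecay`** — `NodeOLettersSqrtAlmostLocal.kernelLetters_invSqrt_almostLocal` with the
  weighted hypotheses `hrow` ∕ `hcol` replaced by the exponential-decay letters `hdec` ∕ `hvol₀` and the rate conditions
  `κ ≤ κ₀/4`, `8aκ·c_V₀ ≤ mκ₀`; conclusion UNCHANGED: `KernelLetters c loc loc (σ u ↦ (P σ u)^{−1/2}) X R θ′ (4/√m)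
  (16B₀c_V²/(m√m))`.
HONEST SCOPE.  Finite sums and one call of the tree theorem; nothing of Bałaban's operators constructed; that HIS
`C*Δ_k(σ,𝐔,𝐉)C` on the domain (1.21) × (2.10) is `m`-accretive and exponentially localised with k-uniform
`(m; a, κ₀, c_V)` is object-level content of [13] (Thm 3.10) ∕ the pin (NODE O ∕ the in-edge), not claimed; the σ-polydisc
direction of (2.16) (smallness `O(1)e^{−⅓δ₀M}` through walks) untouched.  No definition, no instance, no notation, no
`sorry`, no named fact.  NOT continuum, NOT Clay.
-/

noncomputable section

open Set Filter Topology Finset Metric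
open scoped Matrix ComplexConjugate Real

namespace Literature.MathematicalPhysics.QuantumFieldTheory.Balaban1983to89.NodeOLettersSqrtExpDecay

/-! ## §1 Exponential decay ⟹ the weighted Combes–Thomas hypothesis, with a rate uniform in the letters -/

section Core

variable {n : Type*} [Fintype n]

/-- `e^y − 1 ≤ y·e^y` (all real `y`). [folklore] -/
private theorem exp_sub_one_le_mul_exp (y : ℝ) : Real.exp y - 1 ≤ y * Real.exp y := by
  have h := Real.add_one_le_exp (-y)
  have hpos := Real.exp_pos y
  have h1 : Real.exp (-y) * Real.exp y = 1 := by rw [← Real.exp_add, neg_add_cancel, Real.exp_zero]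
  have h2 : (-y + 1) * Real.exp y ≤ 1 := by
    calc (-y + 1) * Real.exp y ≤ Real.exp (-y) * Real.exp y := mul_le_mul_of_nonneg_right h hpos.le
      _ = 1 := h1
  nlinarith [h2]

/-- `x·e^{−x} ≤ 1` (all real `x`). [folklore] -/
private theorem mul_exp_neg_le_one (x : ℝ) : x * Real.exp (-x) ≤ 1 := by
  have h := Real.add_one_le_exp x
  have h1 : Real.exp x * Real.exp (-x) = 1 := by rw [← Real.exp_add, add_neg_cancel, Real.exp_zero]
  calc x * Real.exp (-x) ≤ Real.exp x * Real.exp (-x) :=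
        mul_le_mul_of_nonneg_right (by linarith) (Real.exp_pos _).le
    _ = 1 := h1

/-- **Exponential localisation ⟹ weighted sums LINEAR in the rate (rows).**  If `‖A_{il}‖ ≤ a·e^{−κ₀·d(i,l)}` along the
row `i` (`a ≥ 0`, `κ₀ > 0`, `d(i,·) ≥ 0`) and the HALF-RATE volume sum `Σ_l e^{−(κ₀/2)d(i,l)}` is `≤ c_V`, then for
`0 ≤ κ ≤ κ₀/4` the `(e^{κ·d} − 1)`-weighted absolute row sum is `≤ (4aκ/κ₀)·c_V` (`e^{κt} − 1 ≤ κt·e^{κt}`,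
`t·e^{−κ₀t/4} ≤ 4/κ₀`, `e^{−(κ₀ − κ − κ₀/4)t} ≤ e^{−κ₀t/2}`). (elementary reduction serving the cited localisation step; our proof) [cite: Balaban1988RG2Cluster, (2.7) p.13, (2.16) p.16; Balaban1985BackgroundPropagators, Thm 3.10 p.416] -/
theorem weightedRowSum_le_of_expDecay_linear (d : n → n → ℝ) (A : Matrix n n ℂ) {a κ₀ κ cV : ℝ}
    (ha : 0 ≤ a) (hκ₀ : 0 < κ₀) (hκ : 0 ≤ κ) (hκ4 : κ ≤ κ₀ / 4) (i : n) (hd : ∀ l, 0 ≤ d i l)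
    (hA : ∀ l, ‖A i l‖ ≤ a * Real.exp (-(κ₀ * d i l)))
    (hvol : ∑ l, Real.exp (-(κ₀ / 2 * d i l)) ≤ cV) :
    ∑ l, ‖A i l‖ * (Real.exp (κ * d i l) - 1) ≤ 4 * a * κ / κ₀ * cV := by
  have hterm : ∀ l, ‖A i l‖ * (Real.exp (κ * d i l) - 1) ≤ 4 * a * κ / κ₀ * Real.exp (-(κ₀ / 2 * d i l)) := by
    intro l
    set t : ℝ := d i l with ht
    have h0 : 0 ≤ t := hd l
    have h1 : Real.exp (κ * t) - 1 ≤ κ * t * Real.exp (κ * t) := exp_sub_one_le_mul_exp (κ * t)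
    have h2 : t * Real.exp (-(κ₀ / 4 * t)) ≤ 4 / κ₀ := by
      have h := mul_exp_neg_le_one (κ₀ / 4 * t)
      rw [le_div_iff₀ hκ₀]
      have e : t * Real.exp (-(κ₀ / 4 * t)) * κ₀ = 4 * (κ₀ / 4 * t * Real.exp (-(κ₀ / 4 * t))) := by ring
      rw [e]
      linarith
    have h4 : Real.exp (-((κ₀ - κ - κ₀ / 4) * t)) ≤ Real.exp (-(κ₀ / 2 * t)) := by
      apply Real.exp_le_exp.2
      nlinarith
    have hexp : Real.exp (-(κ₀ * t)) * Real.exp (κ * t)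
        = Real.exp (-(κ₀ / 4 * t)) * Real.exp (-((κ₀ - κ - κ₀ / 4) * t)) := by
      rw [← Real.exp_add, ← Real.exp_add]
      congr 1
      ring
    calc ‖A i l‖ * (Real.exp (κ * t) - 1)
        ≤ (a * Real.exp (-(κ₀ * t))) * (κ * t * Real.exp (κ * t)) :=
          mul_le_mul (hA l) h1 (sub_nonneg.2 (Real.one_le_exp (mul_nonneg hκ h0))) (by positivity)
      _ = a * κ * (t * Real.exp (-(κ₀ / 4 * t))) * Real.exp (-((κ₀ - κ - κ₀ / 4) * t)) := by
          calc (a * Real.exp (-(κ₀ * t))) * (κ * t * Real.exp (κ * t))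
              = a * κ * t * (Real.exp (-(κ₀ * t)) * Real.exp (κ * t)) := by ring
            _ = a * κ * t * (Real.exp (-(κ₀ / 4 * t)) * Real.exp (-((κ₀ - κ - κ₀ / 4) * t))) := by rw [hexp]
            _ = _ := by ring
      _ ≤ a * κ * (4 / κ₀) * Real.exp (-(κ₀ / 2 * t)) :=
          mul_le_mul (mul_le_mul_of_nonneg_left h2 (by positivity)) h4 (Real.exp_pos _).le (by positivity)
      _ = 4 * a * κ / κ₀ * Real.exp (-(κ₀ / 2 * t)) := by ring
  calc ∑ l, ‖A i l‖ * (Real.exp (κ * d i l) - 1)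
      ≤ ∑ l, 4 * a * κ / κ₀ * Real.exp (-(κ₀ / 2 * d i l)) := Finset.sum_le_sum fun l _ => hterm l
    _ = 4 * a * κ / κ₀ * ∑ l, Real.exp (-(κ₀ / 2 * d i l)) := by rw [Finset.mul_sum]
    _ ≤ 4 * a * κ / κ₀ * cV := mul_le_mul_of_nonneg_left hvol (by positivity)

/-- **Exponential localisation ⟹ weighted sums LINEAR in the rate (columns)** — the transpose of
`weightedRowSum_le_of_expDecay_linear`. (elementary reduction serving the cited localisation step; our proof) [cite: Balaban1988RG2Cluster, (2.7) p.13, (2.16) p.16; Balaban1985BackgroundPropagators, Thm 3.10 p.416] -/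
theorem weightedColSum_le_of_expDecay_linear (d : n → n → ℝ) (A : Matrix n n ℂ) {a κ₀ κ cV : ℝ}
    (ha : 0 ≤ a) (hκ₀ : 0 < κ₀) (hκ : 0 ≤ κ) (hκ4 : κ ≤ κ₀ / 4) (l : n) (hd : ∀ i, 0 ≤ d i l)
    (hA : ∀ i, ‖A i l‖ ≤ a * Real.exp (-(κ₀ * d i l)))
    (hvol : ∑ i, Real.exp (-(κ₀ / 2 * d i l)) ≤ cV) :
    ∑ i, ‖A i l‖ * (Real.exp (κ * d i l) - 1) ≤ 4 * a * κ / κ₀ * cV := by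
  have h := weightedRowSum_le_of_expDecay_linear (fun i j => d j i) Aᵀ ha hκ₀ hκ hκ4 l hd
    (fun i => by simpa [Matrix.transpose_apply] using hA i) (by simpa using hvol)
  simpa [Matrix.transpose_apply] using h

/-- **THE k-UNIFORM RATE.**  Under exponential localisation `‖A_{il}‖ ≤ a·e^{−κ₀·d(i,l)}` (`a ≥ 0`, `κ₀ > 0`, `d ≥ 0`)
with half-rate volume sums `≤ c_V` (rows and columns), any `κ` with `0 ≤ κ ≤ κ₀/4` and `8aκ·c_V ≤ mκ₀` gives
`(e^{κ·d} − 1)`-weighted absolute row AND column sums `≤ m/2` — exactly the hypotheses `hrow` ∕ `hcol` (with `ϱ = m/2`)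
of `B13Sqrt27AccretiveAlmostLocal.almostLocal_inverse_decay` ∕ `almostLocal_resolvent_decay` ∕
`norm_invSqrt_apply_le_almostLocal` ∕ `norm_invSqrt_sub_apply_le_almostLocal` ∕ `almostLocal_tilted_inverse_decay` and
of `NodeOLettersSqrtAlmostLocal.kernelLetters_invSqrt_almostLocal`, with `κ` a function of `(m; a, κ₀, c_V)` only.
(elementary reduction serving the cited localisation step; our proof) [cite: Balaban1988RG2Cluster, (2.7) p.13, (2.16) p.16; Balaban1985BackgroundPropagators, Thm 3.10 p.416] -/
theorem weightedSums_le_half_of_expDecay (d : n → n → ℝ) (hdnn : ∀ i l, 0 ≤ d i l) (A : Matrix n n ℂ)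
    {a κ₀ κ cV m : ℝ} (ha : 0 ≤ a) (hκ₀ : 0 < κ₀) (hκ : 0 ≤ κ) (hκ4 : κ ≤ κ₀ / 4)
    (hκm : 8 * a * κ * cV ≤ m * κ₀)
    (hA : ∀ i l, ‖A i l‖ ≤ a * Real.exp (-(κ₀ * d i l)))
    (hvol : ∀ i, ∑ l, Real.exp (-(κ₀ / 2 * d i l)) ≤ cV)
    (hvol' : ∀ l, ∑ i, Real.exp (-(κ₀ / 2 * d i l)) ≤ cV) :
    (∀ i, ∑ l, ‖A i l‖ * (Real.exp (κ * d i l) - 1) ≤ m / 2) ∧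
      (∀ l, ∑ i, ‖A i l‖ * (Real.exp (κ * d i l) - 1) ≤ m / 2) := by
  have hb : 4 * a * κ / κ₀ * cV ≤ m / 2 := by
    have e : 4 * a * κ / κ₀ * cV = (4 * a * κ * cV) / κ₀ := by ring
    rw [e, div_le_iff₀ hκ₀]
    linarith
  exact ⟨fun i => (weightedRowSum_le_of_expDecay_linear d A ha hκ₀ hκ hκ4 i (hdnn i) (fun l => hA i l)
      (hvol i)).trans hb,
    fun l => (weightedColSum_le_of_expDecay_linear d A ha hκ₀ hκ hκ4 l (fun i => hdnn i l) (fun i => hA i l)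
      (hvol' l)).trans hb⟩

omit [Fintype n] in
/-- **A positive uniform rate exists**: for `m > 0`, `κ₀ > 0`, `a ≥ 0`, `c_V ≥ 0` the rate
`κ := min (κ₀/4) (mκ₀/(8a·c_V + 1))` is `> 0`, `≤ κ₀/4`, and satisfies `8aκ·c_V ≤ mκ₀` — so the weighted hypothesis is
met at a STRICTLY POSITIVE rate depending on the letters `(m; a, κ₀, c_V)` only. (elementary reduction serving the cited localisation step; our proof) [cite: Balaban1988RG2Cluster, (2.7) p.13, (2.16) p.16; Balaban1985BackgroundPropagators, Thm 3.10 p.416] -/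
theorem exists_uniform_rate {m a κ₀ cV : ℝ} (hm : 0 < m) (hκ₀ : 0 < κ₀) (ha : 0 ≤ a) (hcV : 0 ≤ cV) :
    ∃ κ : ℝ, 0 < κ ∧ κ ≤ κ₀ / 4 ∧ 8 * a * κ * cV ≤ m * κ₀ := by
  have hden : 0 < 8 * a * cV + 1 := by positivity
  refine ⟨min (κ₀ / 4) (m * κ₀ / (8 * a * cV + 1)), lt_min (by positivity) (div_pos (mul_pos hm hκ₀) hden),
    min_le_left _ _, ?_⟩
  have hle : min (κ₀ / 4) (m * κ₀ / (8 * a * cV + 1)) ≤ m * κ₀ / (8 * a * cV + 1) := min_le_right _ _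
  have hκnn : 0 ≤ min (κ₀ / 4) (m * κ₀ / (8 * a * cV + 1)) :=
    le_min (by positivity) (div_nonneg (mul_nonneg hm.le hκ₀.le) hden.le)
  calc 8 * a * min (κ₀ / 4) (m * κ₀ / (8 * a * cV + 1)) * cV
      = (8 * a * cV) * min (κ₀ / 4) (m * κ₀ / (8 * a * cV + 1)) := by ring
    _ ≤ (8 * a * cV + 1) * (m * κ₀ / (8 * a * cV + 1)) :=
        mul_le_mul (by linarith) hle hκnn hden.le
    _ = m * κ₀ := by field_simp

/-- **Range one ⟹ weighted (rows)**: a kernel of range one in an `ℕ`-valued pseudo-metric `dist` with off-diagonal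
absolute row sums `≤ h` — the hypothesis of `B13Sqrt27Accretive.resolvent_decay` ∕ `NodeOLettersSqrt.kernelLetters_invSqrt`
— has `(e^{κ·dist} − 1)`-weighted row sums `≤ h(e^κ − 1)` (`κ ≥ 0`): the almost-local hypothesis with `d := (dist : ℝ)`,
`ϱ := h(e^κ − 1)`. (elementary; our proof — relates the range-one hypothesis of p422202 ∕ p424729 to the weighted one of p427529 ∕ p427959) [cite: Balaban1988RG2Cluster, (2.7) p.13, (2.16) p.16] -/
theorem weightedRowSum_le_of_rangeOne (dist : n → n → ℕ) (A : Matrix n n ℂ)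
    (hrange : ∀ i j, A i j ≠ 0 → dist i j ≤ 1) {h κ : ℝ} (hκ : 0 ≤ κ)
    (hrow : ∀ i, ∑ j ∈ univ.filter (fun j => dist i j ≠ 0), ‖A i j‖ ≤ h) (i : n) :
    ∑ j, ‖A i j‖ * (Real.exp (κ * dist i j) - 1) ≤ h * (Real.exp κ - 1) := by
  have hκ1 : 0 ≤ Real.exp κ - 1 := sub_nonneg.2 (Real.one_le_exp hκ)
  have hterm : ∀ j, ‖A i j‖ * (Real.exp (κ * dist i j) - 1)
      ≤ (if dist i j ≠ 0 then ‖A i j‖ else 0) * (Real.exp κ - 1) := by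
    intro j
    by_cases hd : dist i j = 0
    · simp [hd]
    · rw [if_pos hd]
      by_cases hA : A i j = 0
      · simp [hA]
      · refine mul_le_mul_of_nonneg_left ?_ (norm_nonneg _)
        have h1 : (dist i j : ℝ) ≤ 1 := by exact_mod_cast hrange i j hA
        have h2 : κ * dist i j ≤ κ := by nlinarith
        linarith [Real.exp_le_exp.2 h2]
  calc ∑ j, ‖A i j‖ * (Real.exp (κ * dist i j) - 1)
      ≤ ∑ j, (if dist i j ≠ 0 then ‖A i j‖ else 0) * (Real.exp κ - 1) := Finset.sum_le_sum fun j _ => hterm j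
    _ = (∑ j ∈ univ.filter (fun j => dist i j ≠ 0), ‖A i j‖) * (Real.exp κ - 1) := by
        rw [Finset.sum_mul, Finset.sum_filter]
        exact Finset.sum_congr rfl fun a _ => by rw [ite_mul, zero_mul]
    _ ≤ h * (Real.exp κ - 1) := mul_le_mul_of_nonneg_right (hrow i) hκ1

/-- **Range one ⟹ weighted (columns)**, the transpose of `weightedRowSum_le_of_rangeOne`. (elementary; our proof — relates the range-one hypothesis of p422202 ∕ p424729 to the weighted one of p427529 ∕ p427959) [cite: Balaban1988RG2Cluster, (2.7) p.13, (2.16) p.16] -/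
theorem weightedColSum_le_of_rangeOne (dist : n → n → ℕ) (A : Matrix n n ℂ)
    (hrange : ∀ i j, A i j ≠ 0 → dist i j ≤ 1) {h κ : ℝ} (hκ : 0 ≤ κ)
    (hcol : ∀ j, ∑ i ∈ univ.filter (fun i => dist i j ≠ 0), ‖A i j‖ ≤ h) (j : n) :
    ∑ i, ‖A i j‖ * (Real.exp (κ * dist i j) - 1) ≤ h * (Real.exp κ - 1) := by
  have h' := weightedRowSum_le_of_rangeOne (fun i j => dist j i) Aᵀ
    (fun i j hij => hrange j i (by simpa [Matrix.transpose_apply] using hij)) hκ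
    (fun i => by simpa [Matrix.transpose_apply] using hcol i) j
  simpa [Matrix.transpose_apply] using h'

end Core

/-! ## §2 NODE O's letters (L1)–(L3) for the square-root family from exponential-decay precision letters -/

section Letters

open Literature.MathematicalPhysics.QuantumFieldTheory.Balaban1983to89
open Literature.MathematicalPhysics.QuantumFieldTheory.Balaban1983to89.B9Thm37GlueTorus (tdist1 tdist1_nonneg tdist1_comm)
open Literature.MathematicalPhysics.QuantumFieldTheory.Balaban1983to89.TreeLengthTorus (TPt)
open Literature.MathematicalPhysics.QuantumFieldTheory.Balaban1983to89.B5TorusCover (UT)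
open Literature.MathematicalPhysics.QuantumFieldTheory.Balaban1983to89.NodeOLetters (distX KernelLetters)
open Literature.MathematicalPhysics.QuantumFieldTheory.Balaban1983to89.B13Sqrt27Accretive (invSqrt)
open Literature.MathematicalPhysics.QuantumFieldTheory.Balaban1983to89.NodeOLettersSqrtAlmostLocal
  (kernelLetters_invSqrt_almostLocal)

variable {d N' : ℕ} {ν : ℕ} {Nf : Fin ν → ℕ} [∀ i, NeZero (Nf i)]
variable {Λ : Type} [Fintype Λ] [DecidableEq Λ]
variable {E : Type*} [NormedAddCommGroup E] [NormedSpace ℂ E]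

/-- **NODE O's LETTERS (L1)–(L3) FOR THE SQUARE-ROOT FAMILY FROM EXPONENTIAL-DECAY PRECISION LETTERS.**  The junction
`NodeOLettersSqrtAlmostLocal.kernelLetters_invSqrt_almostLocal` with its weighted-sum hypotheses `hrow` ∕ `hcol`
DISCHARGED by §1: the precision `P σ u` is `m`-accretive and EXPONENTIALLY LOCALISED in the located torus distance,
`‖(P σ u)_{il}‖ ≤ a·e^{−κ₀·d₁(loc i, loc l)}` (`a ≥ 0`, `κ₀ > 0`), uniformly on the σ-polydisc and the background ball,
with half-rate volume sums `Σ_l e^{−(κ₀/2)d₁(loc i, loc l)} ≤ c_V₀`; the rate `κ` is any number with `0 ≤ κ ≤ κ₀/4`,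
`8aκ·c_V₀ ≤ mκ₀` (one exists with `κ > 0`, `exists_uniform_rate`), and `θ′ + η ≤ κ` as there.  Conclusion unchanged:
`KernelLetters c loc loc (σ u ↦ (P σ u)^{−1/2}) X R θ′ (4/√m) (16B₀c_V²/(m√m))` — every letter a function of the
k-uniform letters `(R, m; a, κ₀, c_V₀; η, c_V; B₀, ρ₀; θ′)`.
[cite: Balaban1988RG2Cluster, (2.7) p.13, (2.16) p.16; Balaban1985BackgroundPropagators, Thm 3.10 p.416] -/
theorem kernelLetters_invSqrt_of_expDecay (c : B13.Consts) (locΛ : Λ → UT Nf) {X : Finset (UT Nf)} (hX : X.Nonempty)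
    (P : (TPt d N' → ℂ) → E → Matrix Λ Λ ℂ)
    {R m a κ₀ κ cV₀ η cV B₀ ρ₀ θ' : ℝ} (hR : 0 < R) (hm : 0 < m) (ha : 0 ≤ a) (hκ₀ : 0 < κ₀) (hκ : 0 ≤ κ)
    (hκ4 : κ ≤ κ₀ / 4) (hκm : 8 * a * κ * cV₀ ≤ m * κ₀)
    (hη : 0 ≤ η) (hB₀ : 0 ≤ B₀) (hθ' : 0 ≤ θ') (hθ'ρ : θ' ≤ ρ₀) (hθ'η : θ' + η ≤ κ)
    (hacc : ∀ σ : TPt d N' → ℂ, (∀ j, ‖σ j‖ ≤ Real.exp c.κ₁) → ∀ u ∈ ball (0 : E) R,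
      ∀ v : Λ → ℂ, m * ∑ i, ‖v i‖ ^ 2 ≤ (∑ i, star (v i) * (P σ u *ᵥ v) i).re)
    (hdec : ∀ σ : TPt d N' → ℂ, (∀ j, ‖σ j‖ ≤ Real.exp c.κ₁) → ∀ u ∈ ball (0 : E) R,
      ∀ i l, ‖P σ u i l‖ ≤ a * Real.exp (-(κ₀ * tdist1 Nf (locΛ i) (locΛ l))))
    (hvol₀ : ∀ i, ∑ l, Real.exp (-(κ₀ / 2 * tdist1 Nf (locΛ i) (locΛ l))) ≤ cV₀)
    (hPloc : ∀ σ : TPt d N' → ℂ, (∀ j, ‖σ j‖ ≤ Real.exp c.κ₁) →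
      ∀ k l, ‖(P σ 0 - P 0 0) k l‖ ≤ B₀ * Real.exp (-(ρ₀ * distX X (locΛ k) (locΛ l))))
    (hPholo : ∀ σ : TPt d N' → ℂ, (∀ j, ‖σ j‖ ≤ Real.exp c.κ₁) →
      ∀ i j, DifferentiableOn ℂ (fun u => P σ u i j) (ball (0 : E) R))
    (hvol : ∀ i, ∑ k, Real.exp (-(η * tdist1 Nf (locΛ i) (locΛ k))) ≤ cV)
    (hvol' : ∀ j, ∑ l, Real.exp (-(η * tdist1 Nf (locΛ l) (locΛ j))) ≤ cV) :
    KernelLetters c locΛ locΛ (fun σ u => invSqrt (P σ u)) X R θ' (4 / Real.sqrt m)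
      (16 * B₀ * cV ^ 2 / (m * Real.sqrt m)) := by
  -- the located torus distance on `Λ`, a nonnegative symmetric kernel
  set dd : Λ → Λ → ℝ := fun i l => tdist1 Nf (locΛ i) (locΛ l) with hdd
  have hdnn : ∀ i l, 0 ≤ dd i l := fun i l => tdist1_nonneg _ _
  -- column volume sums from row volume sums by symmetry of `d₁`
  have hvol₀' : ∀ l, ∑ i, Real.exp (-(κ₀ / 2 * dd i l)) ≤ cV₀ := by
    intro l
    have e : ∀ i, dd i l = dd l i := fun i => tdist1_comm _ _
    simpa [e] using hvol₀ l
  -- §1: the weighted hypothesis at rate `κ` with `ϱ = m/2`, uniformly in `σ, u`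
  have hW : ∀ σ : TPt d N' → ℂ, (∀ j, ‖σ j‖ ≤ Real.exp c.κ₁) → ∀ u ∈ ball (0 : E) R,
      (∀ i, ∑ l, ‖P σ u i l‖ * (Real.exp (κ * dd i l) - 1) ≤ m / 2) ∧
        (∀ l, ∑ i, ‖P σ u i l‖ * (Real.exp (κ * dd i l) - 1) ≤ m / 2) :=
    fun σ hσ u hu => weightedSums_le_half_of_expDecay dd hdnn (P σ u) ha hκ₀ hκ hκ4 hκm (hdec σ hσ u hu) hvol₀ hvol₀'
  exact kernelLetters_invSqrt_almostLocal c locΛ hX P hR hm hκ (by positivity : (0 : ℝ) ≤ m / 2) le_rfl hη hB₀ hθ'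
    hθ'ρ hθ'η hacc (fun σ hσ u hu i => (hW σ hσ u hu).1 i) (fun σ hσ u hu l => (hW σ hσ u hu).2 l) hPloc hPholo
    hvol hvol'

end Letters

end Literature.MathematicalPhysics.QuantumFieldTheory.Balaban1983to89.NodeOLettersSqrtExpDecay

end
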